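import Literature.Computability.Complexity.ShenProtocolPolynomials
import HarnessLib

/-!
# All intermediate polynomials of the `IP = PSPACE` expression: the chain stages, their adjacency
# (downward self-reduction) and a uniform degree bound (Trevisan–Vadhan 2007, Lemma 4.1 (i), (iii))

Consumer of `ShenProtocolPolynomials.lean`. `Shen.shenExpr Q pre rest P` exposes only the block outputs
`Q_v L_{pre} L_v (⋯)`; Trevisan–Vadhan's family `{f_{n,i}}` (Comput. Complexity 16 (2007), §4, Lemma 4.1)
consists of EVERY intermediate polynomial — after each single linearization as well — since (i) "for
`i < m(n)`, `f_{n,i}` can be evaluated with oracle access to `f_{n,i+1}` in time `poly(n)`" needs consecutive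
members to differ by ONE operator, and (iii) "each `f_{n,i}` is of total degree at most `poly(n)`" is needed
for every member (each is self-corrected separately in Thm. 4.3). This file provides them:

* `Shen.chainStage Q P pre v rest s` — the polynomial of block `(pre, v :: rest)` after the chain suffix
  `((pre ++ [v]).drop s)` has been applied to the next block output (`s = 0`: the whole chain;
  `s = |pre| + 1`: nothing yet, i.e. the next block output itself — `chainStage_length`);
* **adjacency** (downward self-reduction, structurally): `shenExpr_cons_chainStage`
  (`block output = Q_v (chainStage 0)`), `chainStage_succ` (`chainStage s = L_u (chainStage (s+1))`, `u` the
  `s`-th chain variable) — together with `Shen.eval_linOp/allOp/exOp` every member's value at a point is an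
  explicit function of two values of the next member;
* **uniform degree bound**: with `B = max (totalDegree P) 2`, every block output and every chain stage has
  degree `≤ B` in every variable (`degreeOf_shenExpr_le_max`, `degreeOf_chainStage_le`), hence total
  degree `≤ |σ| · B` (`totalDegree_chainStage_le`) — Lemma 4.1 (iii) for all members, not only block outputs.

Everything is proved; the only definition is `chainStage`.

## References

* [TrevisanVadhan2007] L. Trevisan, S. Vadhan, Comput. Complexity 16 (2007), §4, Lemma 4.1 (i) and (iii),
  proof sketch ("`fᵢ(x₁,…,x_ℓ)` is defined in terms of `f_{i+1}` using one of the following rules").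
* [AroraBarakCC2009] S. Arora, B. Barak, CUP 2009, §8.3.3 (the expression; "`U = 𝒪 g` where `𝒪` is either
  `∃_{Xᵢ}`, or `∀_{Xᵢ}` or `L_{Xᵢ}`").
-/

noncomputable section

namespace Literature.Computability.Complexity

namespace Shen

open MvPolynomial Finset

variable {R : Type*} [CommRing R] {σ : Type*} [DecidableEq σ]
variable (Q : σ → Bool) (P : MvPolynomial σ R)

/-! ### The chain stages of a block -/

/-- **The `s`-th chain stage of block `(pre, v :: rest)`**: the chain suffix `(pre ++ [v]).drop s` applied to
the next block output. [cite: TrevisanVadhan2007, §4 (Lemma 4.1, proof sketch)] -/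
def chainStage (pre : List σ) (v : σ) (rest : List σ) (s : ℕ) : MvPolynomial σ R :=
  linChain ((pre ++ [v]).drop s) (shenExpr Q (pre ++ [v]) rest P)

/-- The block output is the quantifier operator on the full chain. [cite: AroraBarakCC2009, §8.3.3] -/
theorem shenExpr_cons_chainStage (pre : List σ) (v : σ) (rest : List σ) :
    shenExpr Q pre (v :: rest) P = qop Q v (chainStage Q P pre v rest 0) := by
  rw [shenExpr_cons, chainStage, List.drop_zero]

/-- Past the chain, the stage is the next block output. [folklore] -/
theorem chainStage_length (pre : List σ) (v : σ) (rest : List σ) {s : ℕ} (hs : pre.length + 1 ≤ s) :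
    chainStage Q P pre v rest s = shenExpr Q (pre ++ [v]) rest P := by
  rw [chainStage, List.drop_eq_nil_of_le (by simpa using hs), linChain_nil]

/-- **Adjacency inside a chain**: stage `s` is ONE linearization (in the `s`-th chain variable) of stage
`s + 1`. [cite: TrevisanVadhan2007, §4 (Lemma 4.1 (i), third rule)] -/
theorem chainStage_succ (pre : List σ) (v : σ) (rest : List σ) {s : ℕ} (hs : s < pre.length + 1) :
    chainStage Q P pre v rest s =
      linOp (((pre ++ [v])[s]'(by simpa using hs))) (chainStage Q P pre v rest (s + 1)) := by
  rw [chainStage, chainStage, List.drop_eq_getElem_cons (by simpa using hs), linChain_cons]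

/-! ### A uniform degree bound for every member -/

section Deg

variable [Nontrivial R]

/-- **Block outputs have degree `≤ max (deg P) 2` in every variable** (also the innermost one, which is `P`).
[cite: TrevisanVadhan2007, §4 (Lemma 4.1 (iii))] -/
theorem degreeOf_shenExpr_le_max (rest pre : List σ) (hnd : (pre ++ rest).Nodup) (hcov : ∀ u : σ, u ∈ pre ∨ u ∈ rest)
    (k : σ) : degreeOf k (shenExpr Q pre rest P) ≤ max P.totalDegree 2 := by
  by_cases hr : rest = []
  · subst hr
    rw [shenExpr_nil]
    exact (degreeOf_le_totalDegree P k).trans (le_max_left _ _)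
  · exact (degreeOf_shenExpr_le Q P rest pre hr hnd hcov k).trans (by split_ifs <;> omega)

/-- **Every chain stage has degree `≤ max (deg P) 2` in every variable** (a chain never pushes a degree
above `max (current) 1`). [cite: TrevisanVadhan2007, §4 (Lemma 4.1 (iii))] -/
theorem degreeOf_chainStage_le (pre : List σ) (v : σ) (rest : List σ) (hnd : (pre ++ v :: rest).Nodup)
    (hcov : ∀ u : σ, u ∈ pre ∨ u ∈ v :: rest) (s : ℕ) (k : σ) :
    degreeOf k (chainStage Q P pre v rest s) ≤ max P.totalDegree 2 := by
  have hnd' : ((pre ++ [v]) ++ rest).Nodup := by rwa [List.append_assoc, List.singleton_append]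
  have hcov' : ∀ u : σ, u ∈ pre ++ [v] ∨ u ∈ rest := fun u => by
    rcases hcov u with h | h
    · exact Or.inl (List.mem_append_left _ h)
    · rcases List.mem_cons.1 h with rfl | h
      · exact Or.inl (List.mem_append_right _ (List.mem_singleton_self _))
      · exact Or.inr h
  unfold chainStage
  refine (degreeOf_linChain_le_max k _ _).trans (max_le ?_ ?_)
  · exact degreeOf_shenExpr_le_max Q P rest (pre ++ [v]) hnd' hcov' k
  · exact le_trans one_le_two (le_max_right _ _)

/-- **Total degree of every chain stage**: `≤ |σ| · max (deg P) 2`. [cite: TrevisanVadhan2007, §4 (Lemma 4.1 (iii))] -/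
theorem totalDegree_chainStage_le [Fintype σ] (pre : List σ) (v : σ) (rest : List σ) (hnd : (pre ++ v :: rest).Nodup)
    (hcov : ∀ u : σ, u ∈ pre ∨ u ∈ v :: rest) (s : ℕ) :
    (chainStage Q P pre v rest s).totalDegree ≤ Fintype.card σ * max P.totalDegree 2 := by
  refine (totalDegree_le_sum_degreeOf _).trans ?_
  calc ∑ k : σ, degreeOf k (chainStage Q P pre v rest s) ≤ ∑ _k : σ, max P.totalDegree 2 :=
        Finset.sum_le_sum fun k _ => degreeOf_chainStage_le Q P pre v rest hnd hcov s k
    _ = Fintype.card σ * max P.totalDegree 2 := by simp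

/-- **Total degree of every block output**: `≤ |σ| · max (deg P) 2`. [cite: TrevisanVadhan2007, §4 (Lemma 4.1 (iii))] -/
theorem totalDegree_shenExpr_le_max [Fintype σ] (rest pre : List σ) (hnd : (pre ++ rest).Nodup)
    (hcov : ∀ u : σ, u ∈ pre ∨ u ∈ rest) :
    (shenExpr Q pre rest P).totalDegree ≤ Fintype.card σ * max P.totalDegree 2 := by
  refine (totalDegree_le_sum_degreeOf _).trans ?_
  calc ∑ k : σ, degreeOf k (shenExpr Q pre rest P) ≤ ∑ _k : σ, max P.totalDegree 2 :=
        Finset.sum_le_sum fun k _ => degreeOf_shenExpr_le_max Q P rest pre hnd hcov k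
    _ = Fintype.card σ * max P.totalDegree 2 := by simp

end Deg

/-! ### Values of the members at a point: two queries to the next member -/

/-- **The value of a chain stage** from two values of the next stage (the linearization rule).
[cite: TrevisanVadhan2007, §4 (Lemma 4.1 (i))] [cite: AroraBarakCC2009, §8.3.3 (Case 3)] -/
theorem eval_chainStage_succ (pre : List σ) (v : σ) (rest : List σ) {s : ℕ} (hs : s < pre.length + 1) (x : σ → R) :
    eval x (chainStage Q P pre v rest s) =
      x ((pre ++ [v])[s]'(by simpa using hs)) * eval (Function.update x ((pre ++ [v])[s]'(by simpa using hs)) 1)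
          (chainStage Q P pre v rest (s + 1)) +
        (1 - x ((pre ++ [v])[s]'(by simpa using hs))) * eval (Function.update x ((pre ++ [v])[s]'(by simpa using hs)) 0)
          (chainStage Q P pre v rest (s + 1)) := by
  rw [chainStage_succ Q P pre v rest hs, eval_linOp]

/-- **The value of a block output** from two values of its full chain (the quantifier rules).
[cite: TrevisanVadhan2007, §4 (Lemma 4.1 (i))] [cite: AroraBarakCC2009, §8.3.3 (Cases 1–2)] -/
theorem eval_shenExpr_cons (pre : List σ) (v : σ) (rest : List σ) (x : σ → R) :
    eval x (shenExpr Q pre (v :: rest) P) =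
      if Q v then eval (Function.update x v 0) (chainStage Q P pre v rest 0) * eval (Function.update x v 1) (chainStage Q P pre v rest 0)
      else eval (Function.update x v 0) (chainStage Q P pre v rest 0) + eval (Function.update x v 1) (chainStage Q P pre v rest 0) -
        eval (Function.update x v 0) (chainStage Q P pre v rest 0) * eval (Function.update x v 1) (chainStage Q P pre v rest 0) := by
  rw [shenExpr_cons_chainStage]
  unfold qop
  split_ifs
  · rw [eval_allOp]
  · rw [eval_exOp]

end Shen

end Literature.Computability.Complexity

end
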